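import Summits.KontsevichZagierPeriods.KontsevichZagierPeriods.Theorems.RootDecompWalshStrataBall4Band

/-!
# The 4-ball specimen, part 3/4: the rational 2-cell `R₂` and the planar Dirichlet-polar chart

Route `RootDecompWalshStrata` (cell decomp-kz, lens 4, gen 11), support toward `QuadricSignKernel`
(item stmt-KontsevichZagierPeriods-25393), slice `d = 4`.  After part 2 the orthant of the unit 4-ball
is `[Z, q(1 − u₀² − u₁²)/(2((1 − u₂)² + u₂²))]` on the quarter cylinder `Z`.  This part: the target
rational 2-cell `R₂ = [(0,1)², q/(8((1 − t₀)² + t₀²)((1 − t₁)² + t₁²))]` (`isRational_sqRep`), the source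
domain `A₂ = {y₀,y₁ ∈ (0,1), 0 < y₂, (y₂(1−y₁))² + (y₂y₁)² < 1}` with the pulled-back integrand, and the
DIRICHLET-POLAR chart in the `(u₀,u₁)`-plane, `Ψ₂(y) = (y₂(1 − y₁), y₂y₁, y₀)` (polynomial, Jacobian
`−y₂`, injective on `{y₂ > 0}`, onto `Z`), giving the rule-(2) relation
`[A₂, q(1 − (y₂(1−y₁))² − (y₂y₁)²)·y₂/(2((1 − y₀)² + y₀²))] − [Z, …] ∈ KZ.relations`.  0 sorry.
[KontsevichZagier2001 §1.2 rule (2)]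
-/

noncomputable section
/-- `(1 − v)² + v² > 0`. [folklore] -/
private theorem gq_pos (v : ℝ) : 0 < (1 - v) ^ 2 + v ^ 2 := by nlinarith [sq_nonneg (1 - 2 * v)]

open Literature.NumberTheory.Transcendental
open MeasureTheory Set
open MvPolynomial (aeval X C)
open Literature.ModelTheory.ExponentialFields (IsSemialgebraic isSemialgebraic_setOf_eval_pos
  isSemialgebraic_setOf_eval_lt continuous_aeval_real)
open Summit.KontsevichZagierPeriods.RootDecompWalshStrata.WalshSpanProof (isSemialgebraic_cubeSet
  isBounded_cubeSet cellRep cellRep_domain cellRep_integrand)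
open Summit.KontsevichZagierPeriods.RootDecompWalshStrata.ConeSpecimen (cubeCell_subset_Icc cylPoly
  aeval_cylPoly)

namespace Summit.KontsevichZagierPeriods.RootDecompWalshStrata.Ball4

/-! #### The unit square and the rational 2-cell `R₂` -/

/-- The open unit square `(0,1)²`. -/
def sqSet : Set (Fin 2 → ℝ) := {t | ∀ j, 0 < t j ∧ t j < 1}

/-- `(0,1)²` is `ℚ`-semialgebraic. [BCR1998 §2.1] -/
theorem isSemialgebraic_sqSet : IsSemialgebraic ℚ sqSet := isSemialgebraic_cubeSet 2

/-- `(0,1)² ⊆ [0,1]²`. [folklore] -/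
theorem sqSet_subset_Icc : sqSet ⊆ Icc 0 1 := fun _ ht => ⟨fun j => (ht j).1.le, fun j => (ht j).2.le⟩

/-- `R₂ = [(0,1)², q/(8((1 − t₀)² + t₀²)((1 − t₁)² + t₁²))]`: a RATIONAL function on a rational
2-cell (value `q·π²/32`; a product of two arctangent integrals). [KontsevichZagier2001 §1.1] -/
def sqRep (q : ℚ) : KZ.IntegralRep 2 where
  domain := sqSet
  integrand t := (q : ℝ) / (8 * ((1 - t 0) ^ 2 + t 0 ^ 2) * ((1 - t 1) ^ 2 + t 1 ^ 2))
  isSemialgebraic_domain := isSemialgebraic_sqSet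
  isSemialgebraicFunOn_integrand :=
    (isSemialgebraicFunOn_aeval_div_aeval isSemialgebraic_sqSet (C q)
      (8 * ((1 - X 0) ^ 2 + X 0 ^ 2) * ((1 - X 1) ^ 2 + X 1 ^ 2)) fun t _ => by
        simpa using (mul_pos (mul_pos (by norm_num : (0:ℝ) < 8) (gq_pos (t 0))) (gq_pos (t 1))).ne').congr
      fun t _ => by simp
  integrableOn := by
    refine (ContinuousOn.integrableOn_compact isCompact_Icc ?_).mono_set sqSet_subset_Icc
    have hc : Continuous fun t : Fin 2 → ℝ =>
        (q : ℝ) / (8 * ((1 - t 0) ^ 2 + t 0 ^ 2) * ((1 - t 1) ^ 2 + t 1 ^ 2)) := by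
      refine continuous_const.div ?_ fun t => ?_
      · exact (continuous_const.mul (((continuous_const.sub (continuous_apply 0)).pow 2).add
          ((continuous_apply 0).pow 2))).mul (((continuous_const.sub (continuous_apply 1)).pow 2).add
          ((continuous_apply 1).pow 2))
      · exact (mul_pos (mul_pos (by norm_num : (0:ℝ) < 8) (gq_pos (t 0))) (gq_pos (t 1))).ne'
    exact hc.continuousOn

/-- The domain of `R₂`. [definition] -/
@[simp] theorem sqRep_domain (q : ℚ) : (sqRep q).domain = sqSet := rfl

/-- The integrand of `R₂`. [definition] -/
@[simp] theorem sqRep_integrand (q : ℚ) (t : Fin 2 → ℝ) :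
    (sqRep q).integrand t = (q : ℝ) / (8 * ((1 - t 0) ^ 2 + t 0 ^ 2) * ((1 - t 1) ^ 2 + t 1 ^ 2)) :=
  rfl

/-- **`R₂` is a rational representation of dimension 2.** [KontsevichZagier2001 §1.1] -/
theorem isRational_sqRep (q : ℚ) : (sqRep q).IsRational := by
  refine ⟨C q, 8 * ((1 - X 0) ^ 2 + X 0 ^ 2) * ((1 - X 1) ^ 2 + X 1 ^ 2), fun t _ => ?_, fun t _ => ?_⟩
  · simpa using (mul_pos (mul_pos (by norm_num : (0:ℝ) < 8) (gq_pos (t 0))) (gq_pos (t 1))).ne'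
  · simp

/-! #### The source domain `A₂` and the source representation of the planar chart -/

/-- The cylinder polynomial pulled back along `Ψ₂`: `1 − (y₂(1 − y₁))² − (y₂y₁)²`. -/
def srcPoly₂ : MvPolynomial (Fin 3) ℚ := 1 - (X 2 * (1 - X 1)) ^ 2 - (X 2 * X 1) ^ 2

/-- Evaluation of the pulled-back polynomial. [definition] -/
@[simp] theorem aeval_srcPoly₂ (y : Fin 3 → ℝ) :
    aeval y srcPoly₂ = 1 - (y 2 * (1 - y 1)) ^ 2 - (y 2 * y 1) ^ 2 := by
  simp [srcPoly₂]

/-- The source domain `A₂ = {y | (y₀,y₁) ∈ (0,1)², 0 < y₂, srcPoly₂(y) > 0}`. -/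
def srcSet₂ : Set (Fin 3 → ℝ) :=
  {y | Fin.init y ∈ sqSet ∧ 0 < y (Fin.last 2) ∧ 0 < aeval y srcPoly₂}

/-- Membership in `A₂`, in coordinates. [definition] -/
theorem mem_srcSet₂ {y : Fin 3 → ℝ} :
    y ∈ srcSet₂ ↔ (0 < y 0 ∧ y 0 < 1) ∧ (0 < y 1 ∧ y 1 < 1) ∧ 0 < y 2 ∧
      0 < 1 - (y 2 * (1 - y 1)) ^ 2 - (y 2 * y 1) ^ 2 := by
  simp only [srcSet₂, sqSet, mem_setOf_eq, aeval_srcPoly₂, Fin.init]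
  constructor
  · rintro ⟨hu, h2, hP⟩
    exact ⟨hu 0, hu 1, h2, hP⟩
  · rintro ⟨h0, h1, h2, hP⟩
    refine ⟨fun j => ?_, h2, hP⟩
    fin_cases j
    · exact h0
    · exact h1

/-- `A₂` is `ℚ`-semialgebraic. [BCR1998 §2.1] -/
theorem isSemialgebraic_srcSet₂ : IsSemialgebraic ℚ srcSet₂ := by
  have h := ((isSemialgebraic_sqSet.setOf_init_mem).inter
    (isSemialgebraic_setOf_eval_pos (X (Fin.last 2) : MvPolynomial (Fin 3) ℚ))).inter
    (isSemialgebraic_setOf_eval_pos srcPoly₂)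
  convert h using 1
  ext y
  simp only [srcSet₂, mem_setOf_eq, mem_inter_iff, MvPolynomial.aeval_X, and_assoc]

/-- `A₂ ⊆ [0,2]³` (`y₂ = y₂(1 − y₁) + y₂y₁ < 2`). [folklore] -/
theorem srcSet₂_subset_Icc : srcSet₂ ⊆ Icc 0 2 := by
  intro y hy
  rw [mem_srcSet₂] at hy
  obtain ⟨h0, h1, h2, hP⟩ := hy
  have ha : y 2 * (1 - y 1) < 1 := by
    have hpos : 0 < y 2 * (1 - y 1) := mul_pos h2 (by linarith [h1.2])
    nlinarith [sq_nonneg (y 2 * y 1)]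
  have hb : y 2 * y 1 < 1 := by
    have hpos : 0 < y 2 * y 1 := mul_pos h2 h1.1
    nlinarith [sq_nonneg (y 2 * (1 - y 1))]
  have h2' : y 2 < 2 := by nlinarith
  refine ⟨fun j => ?_, fun j => ?_⟩
  · fin_cases j
    · exact h0.1.le
    · exact h1.1.le
    · exact h2.le
  · fin_cases j
    · simpa using (h0.2.trans one_lt_two).le
    · simpa using (h1.2.trans one_lt_two).le
    · simpa using h2'.le

/-- The pulled-back integrand `q(1 − (y₂(1−y₁))² − (y₂y₁)²)·y₂/(2((1 − y₀)² + y₀²))` is continuous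
on `ℝ³`. [folklore] -/
theorem continuous_srcInt₂ (q : ℚ) : Continuous fun y : Fin 3 → ℝ =>
    (q : ℝ) * (1 - (y 2 * (1 - y 1)) ^ 2 - (y 2 * y 1) ^ 2) * y 2 / (2 * ((1 - y 0) ^ 2 + y 0 ^ 2)) := by
  refine Continuous.div ?_ ?_ fun y => ?_
  · exact (continuous_const.mul ((continuous_const.sub (((continuous_apply 2).mul
      (continuous_const.sub (continuous_apply 1))).pow 2)).sub
      (((continuous_apply 2).mul (continuous_apply 1)).pow 2))).mul (continuous_apply 2)
  · exact continuous_const.mul (((continuous_const.sub (continuous_apply 0)).pow 2).add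
      ((continuous_apply 0).pow 2))
  · exact (mul_pos two_pos (gq_pos (y 0))).ne'

/-- `[A₂, q(1 − (y₂(1−y₁))² − (y₂y₁)²)·y₂/(2((1 − y₀)² + y₀²))]`: the source representation of the
planar chart. [KontsevichZagier2001 §1.1] -/
def srcRep₂ (q : ℚ) : KZ.IntegralRep 3 where
  domain := srcSet₂
  integrand y :=
    (q : ℝ) * (1 - (y 2 * (1 - y 1)) ^ 2 - (y 2 * y 1) ^ 2) * y 2 / (2 * ((1 - y 0) ^ 2 + y 0 ^ 2))
  isSemialgebraic_domain := isSemialgebraic_srcSet₂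
  isSemialgebraicFunOn_integrand :=
    (isSemialgebraicFunOn_aeval_div_aeval isSemialgebraic_srcSet₂
      (C q * (1 - (X 2 * (1 - X 1)) ^ 2 - (X 2 * X 1) ^ 2) * X 2) (2 * ((1 - X 0) ^ 2 + X 0 ^ 2))
      fun y _ => by simpa using (gq_pos (y 0)).ne').congr fun y _ => by simp
  integrableOn :=
    ((continuous_srcInt₂ q).continuousOn.integrableOn_compact isCompact_Icc).mono_set
      srcSet₂_subset_Icc

/-- The domain of the planar source representation. [definition] -/
@[simp] theorem srcRep₂_domain (q : ℚ) : (srcRep₂ q).domain = srcSet₂ := rfl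

/-- The integrand of the planar source representation. [definition] -/
@[simp] theorem srcRep₂_integrand (q : ℚ) (y : Fin 3 → ℝ) :
    (srcRep₂ q).integrand y =
      (q : ℝ) * (1 - (y 2 * (1 - y 1)) ^ 2 - (y 2 * y 1) ^ 2) * y 2 / (2 * ((1 - y 0) ^ 2 + y 0 ^ 2)) :=
  rfl

/-! #### The planar Dirichlet-polar chart `Ψ₂(y) = (y₂(1 − y₁), y₂y₁, y₀)` -/

/-- The chart as a polynomial map. -/
def psi₂Poly : Fin 3 → MvPolynomial (Fin 3) ℚ := ![X 2 * (1 - X 1), X 2 * X 1, X 0]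

/-- `Ψ₂(y) = (y₂(1 − y₁), y₂y₁, y₀)`. -/
def psi₂ : (Fin 3 → ℝ) → (Fin 3 → ℝ) := fun y j => aeval y (psi₂Poly j)

/-- `Ψ₂(y)₀ = y₂(1 − y₁)`. [definition] -/
@[simp] theorem psi₂_zero (y : Fin 3 → ℝ) : psi₂ y 0 = y 2 * (1 - y 1) := by simp [psi₂, psi₂Poly]

/-- `Ψ₂(y)₁ = y₂y₁`. [definition] -/
@[simp] theorem psi₂_one (y : Fin 3 → ℝ) : psi₂ y 1 = y 2 * y 1 := by simp [psi₂, psi₂Poly]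

/-- `Ψ₂(y)₂ = y₀`. [definition] -/
@[simp] theorem psi₂_two (y : Fin 3 → ℝ) : psi₂ y 2 = y 0 := by simp [psi₂, psi₂Poly]

/-- The Jacobian matrix of `Ψ₂`. -/
def psi₂Mat (y : Fin 3 → ℝ) : Matrix (Fin 3) (Fin 3) ℝ :=
  !![0, -(y 2), 1 - y 1; 0, y 2, y 1; 1, 0, 0]

/-- The derivative of `Ψ₂` as a continuous linear map. -/
def psi₂' (y : Fin 3 → ℝ) : (Fin 3 → ℝ) →L[ℝ] (Fin 3 → ℝ) :=
  LinearMap.toContinuousLinearMap (Matrix.toLin' (psi₂Mat y))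

/-- `Ψ₂'(y)` acts by the Jacobian matrix. [calculus] -/
theorem psi₂'_apply (y v : Fin 3 → ℝ) (a : Fin 3) : psi₂' y v a = ∑ b, psi₂Mat y a b * v b := by
  change Matrix.toLin' (psi₂Mat y) v a = _
  rw [Matrix.toLin'_apply]
  rfl

/-- `det Ψ₂'(y) = −y₂`. [calculus] -/
theorem psi₂'_det (y : Fin 3 → ℝ) : (psi₂' y).det = -(y 2) := by
  change LinearMap.det (Matrix.toLin' (psi₂Mat y)) = _
  rw [LinearMap.det_toLin', psi₂Mat, Matrix.det_fin_three]
  simp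
  ring

/-- `Ψ₂` is differentiable with derivative `Ψ₂'`. [calculus] -/
theorem hasFDerivAt_psi₂ (y : Fin 3 → ℝ) : HasFDerivAt psi₂ (psi₂' y) y := by
  have h0 : HasFDerivAt (fun z : Fin 3 → ℝ => psi₂ z 0)
      ((ContinuousLinearMap.proj 0).comp (psi₂' y)) y := by
    have hf : (fun z : Fin 3 → ℝ => psi₂ z 0) = fun z => z 2 * (1 - z 1) := funext psi₂_zero
    rw [hf]
    refine ((hasFDerivAt_apply 2 y).mul ((hasFDerivAt_apply 1 y).const_sub 1)).congr_fderiv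
      (ContinuousLinearMap.ext fun v => ?_)
    simp [psi₂'_apply, psi₂Mat, Fin.sum_univ_three]
  have h1 : HasFDerivAt (fun z : Fin 3 → ℝ => psi₂ z 1)
      ((ContinuousLinearMap.proj 1).comp (psi₂' y)) y := by
    have hf : (fun z : Fin 3 → ℝ => psi₂ z 1) = fun z => z 2 * z 1 := funext psi₂_one
    rw [hf]
    refine ((hasFDerivAt_apply 2 y).mul (hasFDerivAt_apply 1 y)).congr_fderiv
      (ContinuousLinearMap.ext fun v => ?_)
    simp [psi₂'_apply, psi₂Mat, Fin.sum_univ_three]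
  have h2 : HasFDerivAt (fun z : Fin 3 → ℝ => psi₂ z 2)
      ((ContinuousLinearMap.proj 2).comp (psi₂' y)) y := by
    have hf : (fun z : Fin 3 → ℝ => psi₂ z 2) = fun z => z 0 := funext psi₂_two
    rw [hf]
    refine (hasFDerivAt_apply 0 y).congr_fderiv (ContinuousLinearMap.ext fun v => ?_)
    simp [psi₂'_apply, psi₂Mat, Fin.sum_univ_three]
  refine hasFDerivAt_pi'' fun a => ?_
  fin_cases a
  · exact h0
  · exact h1
  · exact h2

/-- `Ψ₂` is injective where `y₂ > 0`. [calculus] -/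
theorem injOn_psi₂ : InjOn psi₂ {y | 0 < y 2} := by
  intro x hx y _ hxy
  have e0 : x 2 * (1 - x 1) = y 2 * (1 - y 1) := by simpa using congrFun hxy 0
  have e1 : x 2 * x 1 = y 2 * y 1 := by simpa using congrFun hxy 1
  have e2 : x 0 = y 0 := by simpa using congrFun hxy 2
  have h2 : x 2 = y 2 := by linear_combination e0 + e1
  have h1 : x 1 = y 1 := by
    have h : x 2 * x 1 = x 2 * y 1 := by rw [e1, h2]
    exact mul_left_cancel₀ (ne_of_gt hx) h
  funext a
  fin_cases a
  · exact e2
  · exact h1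
  · exact h2

/-- `Ψ₂` maps `A₂` onto the quarter cylinder `Z` (inverse `y = (u₂, u₁/(u₀+u₁), u₀+u₁)`).
[calculus] -/
theorem image_psi₂ : psi₂ '' srcSet₂ = cylSet := by
  ext u
  simp only [mem_image, cylSet, mem_setOf_eq, aeval_cylPoly]
  constructor
  · rintro ⟨y, hy, rfl⟩
    rw [mem_srcSet₂] at hy
    obtain ⟨h0, h1, h2, hP⟩ := hy
    have ha0 : 0 < y 2 * (1 - y 1) := mul_pos h2 (by linarith [h1.2])
    have hb0 : 0 < y 2 * y 1 := mul_pos h2 h1.1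
    have ha : y 2 * (1 - y 1) < 1 := by nlinarith [sq_nonneg (y 2 * y 1)]
    have hb : y 2 * y 1 < 1 := by nlinarith [sq_nonneg (y 2 * (1 - y 1))]
    refine ⟨fun j => ?_, by simpa using hP⟩
    fin_cases j
    · simpa using ⟨ha0, ha⟩
    · simpa using ⟨hb0, hb⟩
    · simpa using h0
  · rintro ⟨hu, hP⟩
    have hu0 := hu 0
    have hu1 := hu 1
    have hu2 := hu 2
    have hs : 0 < u 0 + u 1 := add_pos hu0.1 hu1.1
    have hne : u 0 + u 1 ≠ 0 := hs.ne'
    refine ⟨![u 2, u 1 / (u 0 + u 1), u 0 + u 1], ?_, ?_⟩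
    · rw [mem_srcSet₂]
      simp only [Matrix.cons_val_zero, Matrix.cons_val_one, Matrix.cons_val]
      refine ⟨hu2, ⟨div_pos hu1.1 hs, (div_lt_one hs).2 (by linarith [hu0.1])⟩, hs, ?_⟩
      have e0 : (u 0 + u 1) * (1 - u 1 / (u 0 + u 1)) = u 0 := by field_simp; ring
      have e1 : (u 0 + u 1) * (u 1 / (u 0 + u 1)) = u 1 := by field_simp
      rw [e0, e1]
      linarith
    · funext a
      fin_cases a
      · simp only [Fin.reduceFinMk, psi₂_zero, Matrix.cons_val]
        field_simp
        ring
      · simp only [Fin.reduceFinMk, psi₂_one, Matrix.cons_val]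
        field_simp
      · simp

/-- **Move (2), planar chart:** `[A₂, …] − [Z, q(1 − u₀² − u₁²)/(2((1 − u₂)² + u₂²))] ∈ KZ.relations`
(`|det Ψ₂'| = y₂`). [KontsevichZagier2001 §1.2 rule (2)] -/
theorem of_srcRep₂_sub_of_cylWRep_mem_relations (q : ℚ) :
    KZ.of (srcRep₂ q) - KZ.of (cylWRep q) ∈ KZ.relations := by
  refine KZ.changeOfVariablesRel_subset_relations
    ⟨3, srcRep₂ q, cylWRep q, psi₂, psi₂', ?_,
      fun y _ => (hasFDerivAt_psi₂ y).hasFDerivWithinAt,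
      injOn_psi₂.mono fun y hy => (mem_srcSet₂.1 hy).2.2.1, ?_, fun y hy => ?_, rfl⟩
  · exact isSemialgebraicMapOn_aeval (srcRep₂ q).isSemialgebraic_domain psi₂Poly
  · rw [cylWRep_domain, srcRep₂_domain, image_psi₂]
  · have h2 : 0 < y 2 := (mem_srcSet₂.1 hy).2.2.1
    rw [srcRep₂_integrand, cylWRep_integrand, psi₂'_det, abs_neg, abs_of_pos h2, psi₂_zero, psi₂_one,
      psi₂_two]
    ring

end Summit.KontsevichZagierPeriods.RootDecompWalshStrata.Ball4

end
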